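import Summits.CriticalPhenomena.CardyFormulaZ2.Theorems.CardyIKTransportIKLinearTransportSDEPlumb3

/-!
# Stub `stub_StripDiagramExchange` — plumbing part 4: the off-data of a glued configuration

Continues `…SDEPlumb3`. The observables with the middle data erased, of a coded configuration agreeing with `b₁` off the
middle coordinates, are an explicit measurable function `SDE.EE i S b₁` of the boundary colourings `(ξ, ζ)` of the
explicit strip model read off its core bits (`SDE.eraseMid_ObsJ_off`); `EE` reads the column pattern only off the two
exchanged columns (`SDE.EE_congr`).
-/

set_option autoImplicit false

noncomputable section

namespace Summit.CriticalPhenomena.CardyFormulaZ2.Theorems.IKLinearTransport.PinnedDiagramExchange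

open scoped Classical MeasureTheory ENNReal ProbabilityTheory BigOperators
open MeasureTheory Literature.Probability.Percolation Literature.Probability.LatticeModels

namespace SDE

/-! ## §7 The off-data of a glued configuration as a function of the boundary colourings -/

/-- Values of a glued configuration off the middle coordinates. [folklore] -/
theorem glue_off (i : ℤ) (b₁ b₂ : KJ) :
    (∀ x : ℤ, x ≠ i + 1 → glue (Amid i) b₁ b₂ (Sum.inl x) = b₁ (Sum.inl x)) ∧
    (∀ y : ℤ, glue (Amid i) b₁ b₂ (Sum.inr (Sum.inl y)) = b₂ (Sum.inr (Sum.inl y))) ∧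
    (∀ f : Site 2, f 0 ≠ i → f 0 ≠ i + 1 →
      glue (Amid i) b₁ b₂ (Sum.inr (Sum.inr (Sum.inl f))) = b₁ (Sum.inr (Sum.inr (Sum.inl f))) ∧
      glue (Amid i) b₁ b₂ (Sum.inr (Sum.inr (Sum.inr (Sum.inl f)))) = b₁ (Sum.inr (Sum.inr (Sum.inr (Sum.inl f)))) ∧
      glue (Amid i) b₁ b₂ (Sum.inr (Sum.inr (Sum.inr (Sum.inr f)))) = b₁ (Sum.inr (Sum.inr (Sum.inr (Sum.inr f))))) := by
  refine ⟨fun x hx => ?_, fun y => ?_, fun f h1 h2 => ⟨?_, ?_, ?_⟩⟩ <;>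
    simp [glue, Amid, *]

/-- Off the two exchanged face columns, a configuration agreeing there with `b₁` reads `b₁`'s plaquettes. [folklore] -/
theorem parJ_off (i : ℤ) (S : Set ℤ) (b₁ g : KJ)
    (hf : ∀ f : Site 2, f 0 ≠ i → f 0 ≠ i + 1 →
      g (Sum.inr (Sum.inr (Sum.inl f))) = b₁ (Sum.inr (Sum.inr (Sum.inl f))) ∧
      g (Sum.inr (Sum.inr (Sum.inr (Sum.inl f)))) = b₁ (Sum.inr (Sum.inr (Sum.inr (Sum.inl f)))) ∧
      g (Sum.inr (Sum.inr (Sum.inr (Sum.inr f)))) = b₁ (Sum.inr (Sum.inr (Sum.inr (Sum.inr f)))))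
    (f : Site 2) (h1 : f 0 ≠ i) (h2 : f 0 ≠ i + 1) : parJ S g f = parJ S b₁ f := by
  obtain ⟨e1, e2, -⟩ := hf f h1 h2
  simp only [parJ, e1, e2]

/-- Splitting an anchored rectangle parity at a column. [folklore] -/
theorem odd_card_split (P : ℤ × ℤ → Prop) [DecidablePred P] {a b c : ℤ} (hab : a ≤ b) (hbc : b ≤ c) (B : Finset ℤ) :
    Odd ((Finset.Ico a c ×ˢ B).filter P).card ↔
      Xor (Odd ((Finset.Ico a b ×ˢ B).filter P).card) (Odd ((Finset.Ico b c ×ˢ B).filter P).card) := by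
  rw [← Finset.Ico_union_Ico_eq_Ico hab hbc, Finset.union_product, Finset.filter_union, Finset.card_union_of_disjoint,
    odd_add_xor]
  exact Finset.disjoint_filter_filter (Finset.disjoint_left.2 fun x h1 h2 => by
    rw [Finset.mem_product, Finset.mem_Ico] at h1 h2; omega)

/-- THE OFF-DATA MAP: the erased observables of a glued configuration, from the first sample and the boundary
colourings `(ξ, ζ)` of the strip. [folklore] -/
def EE (i : ℤ) (S : Set ℤ) (b₁ : KJ) (ξζ : (ℤ → Bool) × (ℤ → Bool)) : Obs :=
  ({v | v 0 ≠ i + 1 ∧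
      ((v 0 < i ∧ Xor (b₁ (Sum.inl (v 0)) = true) (Xor ((ξζ.1 (v 1) ^^ b₁ (Sum.inl i)) = true)
          (Odd ((Finset.filter (fun f : ℤ × ℤ => parJ S b₁ ![f.1, f.2] = true)
            (Finset.Ico (v 0) i ×ˢ Finset.Ico (min 0 (v 1)) (max 0 (v 1)))).card)))) ∨
       (v 0 = i ∧ ξζ.1 (v 1) = true) ∨ (v 0 = i + 2 ∧ ξζ.2 (v 1) = true) ∨
       (i + 2 < v 0 ∧ Xor (b₁ (Sum.inl (v 0)) = true) (Xor ((ξζ.2 (v 1) ^^ b₁ (Sum.inl (i + 2))) = true)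
          (Odd ((Finset.filter (fun f : ℤ × ℤ => parJ S b₁ ![f.1, f.2] = true)
            (Finset.Ico (i + 2) (v 0) ×ˢ Finset.Ico (min 0 (v 1)) (max 0 (v 1)))).card)))))},
   {f | (f 0 ≠ i ∧ f 0 ≠ i + 1) ∧ (f 0 ∉ S ∨ b₁ (Sum.inr (Sum.inr (Sum.inr (Sum.inr f)))) = true)})

/-- The off-data map only reads the column pattern off the two exchanged columns. [folklore] -/
theorem EE_congr (i : ℤ) {S S' : Set ℤ} (hS : ∀ x : ℤ, x ≠ i → x ≠ i + 1 → (x ∈ S' ↔ x ∈ S)) (b₁ : KJ) :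
    EE i S' b₁ = EE i S b₁ := by
  have hpar : ∀ (a c : ℤ) (v : Site 2), (c ≤ i ∨ i + 2 ≤ a) →
      (Finset.filter (fun f : ℤ × ℤ => parJ S' b₁ ![f.1, f.2] = true) (Finset.Ico a c ×ˢ Finset.Ico (min 0 (v 1)) (max 0 (v 1)))) =
      (Finset.filter (fun f : ℤ × ℤ => parJ S b₁ ![f.1, f.2] = true) (Finset.Ico a c ×ˢ Finset.Ico (min 0 (v 1)) (max 0 (v 1)))) := by
    intro a c v hac
    refine Finset.filter_congr fun f hf => ?_
    rw [Finset.mem_product, Finset.mem_Ico] at hf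
    have e : ((![f.1, f.2] : Site 2) 0 ∈ S') ↔ ((![f.1, f.2] : Site 2) 0 ∈ S) := hS _ (by simp; omega) (by simp; omega)
    simp only [parJ, e]
  funext ξζ
  refine Prod.ext (Set.ext fun v => ?_) (Set.ext fun f => ?_)
  · simp only [EE, Set.mem_setOf_eq]
    rw [hpar (v 0) i v (Or.inl le_rfl), hpar (i + 2) (v 0) v (Or.inr le_rfl)]
  · simp only [EE, Set.mem_setOf_eq]
    constructor
    · rintro ⟨h1, h2⟩; exact ⟨h1, by rwa [← hS (f 0) h1.1 h1.2]⟩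
    · rintro ⟨h1, h2⟩; exact ⟨h1, by rwa [hS (f 0) h1.1 h1.2]⟩

/-- `Xor` rearrangements. [folklore] -/
theorem xor_solve {A R O₁ O₂ X Z K : Prop} (hZ : Xor A (Xor R O₁) ↔ Z) (hK : K ↔ Xor Z A) :
    Xor X (Xor R (Xor O₁ O₂)) ↔ Xor X (Xor K O₂) := by
  rw [hK]
  by_cases hA : A <;> by_cases hR : R <;> by_cases h1 : O₁ <;> by_cases h2 : O₂ <;> by_cases hX : X <;>
    simp only [Xor, hA, hR, h1, h2, hX, not_true, not_false_iff, true_and, false_and, and_true, and_false, or_true,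
      or_false, false_or, true_iff, false_iff, not_not] at hZ ⊢ <;> tauto

/-- THE OFF-DATA OF A CONFIGURATION AGREEING WITH `b₁` OFF THE MIDDLE: erasing the middle data of its observables
leaves `EE i S b₁` applied to the boundary colourings of the strip model read off its core bits. [folklore] -/
theorem eraseMid_ObsJ_off (i : ℤ) (S : Set ℤ) (h : i ∈ S ↔ i + 1 ∉ S) (τ : Bool) (hτ : decide (i ∈ S) = τ) (b₁ g : KJ)
    (hx : ∀ x : ℤ, x ≠ i + 1 → g (Sum.inl x) = b₁ (Sum.inl x))
    (hf : ∀ f : Site 2, f 0 ≠ i → f 0 ≠ i + 1 →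
      g (Sum.inr (Sum.inr (Sum.inl f))) = b₁ (Sum.inr (Sum.inr (Sum.inl f))) ∧
      g (Sum.inr (Sum.inr (Sum.inr (Sum.inl f)))) = b₁ (Sum.inr (Sum.inr (Sum.inr (Sum.inl f)))) ∧
      g (Sum.inr (Sum.inr (Sum.inr (Sum.inr f)))) = b₁ (Sum.inr (Sum.inr (Sum.inr (Sum.inr f))))) :
    eraseMid i (ObsJ i S g) = EE i S b₁ (bdry (b₁ (Sum.inl i)) (b₁ (Sum.inl (i + 2))) (coreOf i τ g)) := by
  have hgi : g (Sum.inl i) = b₁ (Sum.inl i) := hx i (by omega)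
  have hgi2 : g (Sum.inl (i + 2)) = b₁ (Sum.inl (i + 2)) := hx (i + 2) (by omega)
  have hξ : ∀ y, ((bdry (b₁ (Sum.inl i)) (b₁ (Sum.inl (i + 2))) (coreOf i τ g)).1 y ^^ b₁ (Sum.inl i)) = g (Sum.inr (Sum.inl y)) := by
    intro y
    simp only [bdry, coreOf, (ιc_apply i τ y).1]
    cases b₁ (Sum.inl i) <;> cases g (Sum.inr (Sum.inl y)) <;> rfl
  have hpar : ∀ (a c : ℤ) (v : Site 2), (c ≤ i ∨ i + 2 ≤ a) →
      (Finset.filter (fun f : ℤ × ℤ => parJ S g ![f.1, f.2] = true) (Finset.Ico a c ×ˢ Finset.Ico (min 0 (v 1)) (max 0 (v 1)))) =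
      (Finset.filter (fun f : ℤ × ℤ => parJ S b₁ ![f.1, f.2] = true) (Finset.Ico a c ×ˢ Finset.Ico (min 0 (v 1)) (max 0 (v 1)))) := by
    intro a c v hac
    refine Finset.filter_congr fun f hf' => ?_
    rw [Finset.mem_product, Finset.mem_Ico] at hf'
    rw [parJ_off i S b₁ g hf _ (by simp; omega) (by simp; omega)]
  have h0 : ∀ v : Site 2, v 0 = i → (v ∈ (ObsJ i S g).1 ↔ (bdry (b₁ (Sum.inl i)) (b₁ (Sum.inl (i + 2))) (coreOf i τ g)).1 (v 1) = true) := by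
    intro v e; rw [memObsJ_col0 i S τ g v e, hgi, hgi2]; rfl
  have h2 : ∀ v : Site 2, v 0 = i + 2 → (v ∈ (ObsJ i S g).1 ↔ (bdry (b₁ (Sum.inl i)) (b₁ (Sum.inl (i + 2))) (coreOf i τ g)).2 (v 1) = true) := by
    intro v e; rw [memObsJ_col2 i S h g v e, hτ, hgi, hgi2]; rfl
  refine Prod.ext (Set.ext fun v => ?_) (Set.ext fun f => ?_)
  · have hζ := h2 ![i + 2, v 1] (by simp)
    simp only [ObsJ, Set.mem_setOf_eq, Matrix.cons_val_zero, Matrix.cons_val_one, min_eq_left (show i ≤ i + 2 by omega),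
      max_eq_right (show i ≤ i + 2 by omega), hgi2] at hζ
    simp only [eraseMid, Set.mem_setOf_eq, EE, hξ]
    constructor
    · rintro ⟨hv, hne⟩
      refine ⟨hne, ?_⟩
      rcases (show v 0 < i ∨ v 0 = i ∨ v 0 = i + 2 ∨ i + 2 < v 0 by omega) with e | e | e | e
      · left; refine ⟨e, ?_⟩
        simp only [ObsJ, Set.mem_setOf_eq, min_eq_right e.le, max_eq_left e.le, hx (v 0) hne] at hv
        rwa [hpar (v 0) i v (Or.inl le_rfl)] at hv
      · right; left; exact ⟨e, (h0 v e).1 hv⟩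
      · right; right; left; exact ⟨e, (h2 v e).1 hv⟩
      · right; right; right; refine ⟨e, ?_⟩
        simp only [ObsJ, Set.mem_setOf_eq, min_eq_left (show i ≤ v 0 by omega), max_eq_right (show i ≤ v 0 by omega),
          hx (v 0) hne] at hv
        rw [odd_card_split _ (show i ≤ i + 2 by omega) (by omega), hpar (i + 2) (v 0) v (Or.inr le_rfl)] at hv
        exact (xor_solve hζ (xor_eq_true _ _ |>.symm |> Iff.trans (by rw [Bool.xor_comm]))).1 hv
    · rintro ⟨hne, hv⟩
      refine ⟨?_, hne⟩
      rcases hv with ⟨e, hv⟩ | ⟨e, hv⟩ | ⟨e, hv⟩ | ⟨e, hv⟩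
      · simp only [ObsJ, Set.mem_setOf_eq, min_eq_right e.le, max_eq_left e.le, hx (v 0) hne]
        rwa [hpar (v 0) i v (Or.inl le_rfl)]
      · exact (h0 v e).2 hv
      · exact (h2 v e).2 hv
      · simp only [ObsJ, Set.mem_setOf_eq, min_eq_left (show i ≤ v 0 by omega), max_eq_right (show i ≤ v 0 by omega),
          hx (v 0) hne]
        rw [odd_card_split _ (show i ≤ i + 2 by omega) (by omega), hpar (i + 2) (v 0) v (Or.inr le_rfl)]
        exact (xor_solve hζ (xor_eq_true _ _ |>.symm |> Iff.trans (by rw [Bool.xor_comm]))).2 hv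
  · simp only [eraseMid, Set.mem_setOf_eq, EE, ObsJ]
    constructor
    · rintro ⟨hv, h1, h2'⟩; exact ⟨⟨h1, h2'⟩, by rwa [(hf f h1 h2').2.2] at hv⟩
    · rintro ⟨⟨h1, h2'⟩, hv⟩; exact ⟨by rwa [(hf f h1 h2').2.2], h1, h2'⟩


end SDE

/-- OFF-DATA FACTORISATION (plumbing part 4 of `stub_StripDiagramExchange`). [folklore] -/
theorem stripDX_offFactor : ∀ (i : ℤ) (S : Set ℤ), (i ∈ S ↔ i + 1 ∉ S) → ∀ (τ : Bool), decide (i ∈ S) = τ → ∀ (b₁ g : SDE.KJ), (∀ x : ℤ, x ≠ i + 1 → g (Sum.inl x) = b₁ (Sum.inl x)) → (∀ f : Site 2, f 0 ≠ i → f 0 ≠ i + 1 → g (Sum.inr (Sum.inr (Sum.inl f))) = b₁ (Sum.inr (Sum.inr (Sum.inl f))) ∧ g (Sum.inr (Sum.inr (Sum.inr (Sum.inl f)))) = b₁ (Sum.inr (Sum.inr (Sum.inr (Sum.inl f)))) ∧ g (Sum.inr (Sum.inr (Sum.inr (Sum.inr f)))) = b₁ (Sum.inr (Sum.inr (Sum.inr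 (Sum.inr f))))) → eraseMid i (SDE.ObsJ i S g) = SDE.EE i S b₁ (SDE.bdry (b₁ (Sum.inl i)) (b₁ (Sum.inl (i + 2))) (SDE.coreOf i τ g)) :=
  fun i S h τ hτ b₁ g hx hf => SDE.eraseMid_ObsJ_off i S h τ hτ b₁ g hx hf

end Summit.CriticalPhenomena.CardyFormulaZ2.Theorems.IKLinearTransport.PinnedDiagramExchange
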